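import Mathlib.Tactic.DeriveFintype
import Mathlib.Algebra.Group.Defs
import HarnessLib

/-!
# Venture HSemireg — kernel index of the holomorphic-Lefschetz character table on `E_ω × E_ω`

Bookkeeping of the computation cell `pub-hsemireg`, seat w1-aut-1 (note
`widen/W1/M3CHAR-w1aut1.md` v1.0 §1–§2, script `widen/W1/w1aut1/m3char/lefschetz.py`).

SETTING (all of it lives in the note, not in this file). `E : y² = x³ − 1`, `ζ : (x, y) ↦ (ωx, −y)`
is the automorphism `[u]`, `u = −ω`; it multiplies `dx/y` and the uniformiser `x/y` by `u`.  A class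
`v` has CHARACTER `k ∈ ℤ/6` iff `ζ* v = ζ₆^k v` with `ζ₆ := u⁻¹ = 1 + ω` (pull-back of functions;
the convention of the cell's `charges.py`: `x ↦ 2`, `y ↦ 3`, `x²/(2y) ↦ 1`).  `ζ` acts diagonally on
`S = E × E`; the divisors `p = {x₁-factor at o}`, `q = {x₂-factor at o}`, `c_z = graph of [ω^z]` are
`ζ`-stable with local equations that are `u`-eigenfunctions, so at a fixed point `Q = (P₁, P₂)` the
local generator of `𝒪(D)`, `D = a p + b q + Σ n_z c_z`, has character
`m_D(Q) = a[P₁ = o] + b[P₂ = o] + Σ n_z [P₂ = ω^z P₁]`.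
PREMISE (Atiyah–Bott holomorphic Lefschetz formula, isolated fixed points, `dζ^j = u^j · Id`):
`Σ_q (−1)^q Tr(ζ^{j*} | H^q(S, 𝒪(D))) = Σ_{Q ∈ Fix(ζ^j)} ζ₆^{j m_D(Q)} / (1 − u^j)²`, with
`Fix(ζ^j)` on `E` `= ℤ[ω]/(u^j − 1)` (sizes `1, 3, 4, 3, 1` for `j = 1, …, 5`).

WHAT THIS FILE CHECKS, by `decide` on integer pairs (`ℤ[ω]` modelled as in `SlotFrameHexagon`, local copy):
* the five representative lists of `ℤ[ω]/(u^j − 1)` are complete residue systems (right size,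
  pairwise incongruent);
* for 21 divisors `D` and the character multisets CLAIMED for `H^*(S, 𝒪(D))` (degree by degree), the
  identity `(1 − u^j)² · Σ_i (−1)^i Σ_{k ∈ chars_i} ζ₆^{jk} = Σ_{Q} ζ₆^{j m_D(Q)}` holds for every
  `j = 1, …, 5`, and `Σ_i (−1)^i |chars_i| = χ(𝒪(D)) = det M_D` (Mumford; `M_D` the Hermitian form of
  `SlotFrameHexagon`).
Given the premise, these identities DETERMINE the characters whenever the cohomology sits in one degree
(non-degenerate `D`: 15 of the 21 rows); for the degenerate rows (`𝒪`, `𝒪(c₁)`, `𝒪(−c_z)`,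
`𝒪(2H − c₁)`, `𝒪(c₁ − 2H)`) the split between the two non-zero degrees is the note's fibration
argument, and the file only certifies that the claimed split is CONSISTENT with the fixed-point sums.
The twelve rows that the cell's `charges.py` printed (explicit Čech cocycles) are among the 21 and agree:
`H¹(𝒪) [1,1]`, `H²(𝒪) [2]`, `H⁰(𝒪(c_z)) [0]`, `H¹(𝒪(−c_z)) [1]`, `H⁰(𝒪(2H − c_z)) [2]`,
`H¹(𝒪(c_z − 2H)) [5]`, `H¹(𝒪(𝒫_z)) [0]`, `H¹(𝒪(−𝒫_z)) [2]`, `H²(𝒪(−2H)) {0,0,2,4}`,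
`H¹(𝒪(c₀ − c₁)) {1,1,4}`.

HONEST FRAMING: finite integer arithmetic only; the fixed-point formula, the identification of the
fixed points and of the local characters, and everything about sheaves, A∞-structures or the
semiregularity map are the note's, not the kernel's.  Nothing in this file says that HC, HC_CM or
HC_AV holds, and nothing here is a new case of anything.
-/

namespace Summit.Ventures.HSemireg

namespace LefschetzCharacterIndex

/-! ### Local copy of the `ℤ[ω]` / Hermitian arithmetic (same conventions as `SlotFrameHexagon`;
kept local so that this file elaborates on its own). -/

/-- Eisenstein integers as pairs: `⟨a, b⟩ = a + b ω`, `ω² = −1 − ω`. -/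
structure Eis where
  /-- coefficient of `1` -/
  a : ℤ
  /-- coefficient of `ω` -/
  b : ℤ
deriving DecidableEq, Repr

namespace Eis
/-- addition -/
def add (x y : Eis) : Eis := ⟨x.a + y.a, x.b + y.b⟩
/-- negation -/
def neg (x : Eis) : Eis := ⟨-x.a, -x.b⟩
/-- subtraction -/
def sub (x y : Eis) : Eis := add x (neg y)
/-- multiplication: `(a + bω)(c + dω) = (ac − bd) + (ad + bc − bd) ω` -/
def mul (x y : Eis) : Eis := ⟨x.a * y.a - x.b * y.b, x.a * y.b + x.b * y.a - x.b * y.b⟩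
/-- complex conjugation: `conj (a + bω) = (a − b) − b ω` -/
def conj (x : Eis) : Eis := ⟨x.a - x.b, -x.b⟩
/-- the norm `x · conj x` (an integer) -/
def norm (x : Eis) : ℤ := x.a * x.a - x.a * x.b + x.b * x.b
/-- `0` -/
def zero : Eis := ⟨0, 0⟩
/-- `1` -/
def one : Eis := ⟨1, 0⟩
/-- `ω` -/
def om : Eis := ⟨0, 1⟩
/-- `ζ = 1 + ω = −ω̄`, a primitive sixth root of unity (`ζ₆` of the docstring) -/
def zeta : Eis := ⟨1, 1⟩
/-- `ζ^k` by iterated multiplication -/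
def zpow : ℕ → Eis
  | 0 => one
  | k + 1 => mul (zpow k) zeta
end Eis

open Eis

/-- A 2×2 Hermitian matrix over `ℤ[ω]`: `[[m11, m12],[conj m12, m22]]` with integer diagonal
(the Néron–Severi class of a divisor on `S`, as in `SlotFrameHexagon`). -/
structure Herm where
  /-- top-left entry -/
  m11 : ℤ
  /-- top-right entry -/
  m12 : Eis
  /-- bottom-right entry -/
  m22 : ℤ
deriving DecidableEq, Repr

namespace Herm
/-- sum -/
def add (A B : Herm) : Herm := ⟨A.m11 + B.m11, Eis.add A.m12 B.m12, A.m22 + B.m22⟩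
/-- integer multiple -/
def smul (k : ℤ) (A : Herm) : Herm := ⟨k * A.m11, ⟨k * A.m12.a, k * A.m12.b⟩, k * A.m22⟩
/-- determinant `m11 m22 − N(m12)` (= `χ` of the line bundle, Mumford) -/
def det (A : Herm) : ℤ := A.m11 * A.m22 - Eis.norm A.m12
/-- the rank-one form `ψ† ψ` of a row `ψ = (s, t)`: the class of the sub-torus `ker ψ` -/
def rank1 (s t : Eis) : Herm := ⟨Eis.norm s, Eis.mul (Eis.conj s) t, Eis.norm t⟩
/-- `p` -/
def P : Herm := ⟨1, Eis.zero, 0⟩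
/-- `q` -/
def Q : Herm := ⟨0, Eis.zero, 1⟩
/-- the graph `Γ(f) = {y = f x} = ker(−f, 1)` -/
def Gam (f : Eis) : Herm := rank1 (Eis.neg f) Eis.one
/-- `c_z = Γ(ω^z)` for `z = 0, 1, 2` -/
def c (z : ℕ) : Herm := Gam (zpow (2 * z))
end Herm

open Herm

/-- `u = −ω = ζ₆⁵`, the tangent multiplier of `ζ`. -/
def u : Eis := ⟨0, -1⟩

/-- `u^j` as a power of `ζ₆ = 1 + ω` (`u = ζ₆^5`). -/
def upow (j : ℕ) : Eis := zpow (5 * j % 6)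

/-- `ζ₆^k` for an integer exponent (reduced mod 6). -/
def zpowInt (k : ℤ) : Eis := zpow (Int.toNat (k % 6))

/-- divisibility `m ∣ x` in `ℤ[ω]` for `m ≠ 0`: `x · conj m ≡ 0 (mod N(m))` componentwise. -/
def dvd (m x : Eis) : Bool :=
  let y := mul x (conj m)
  (y.a % norm m == 0) && (y.b % norm m == 0)

/-- congruence modulo `u^j − 1`. -/
def cong (j : ℕ) (x y : Eis) : Bool := dvd (sub (upow j) one) (sub x y)

/-- representatives of `Fix(ζ^j) = ℤ[ω]/(u^j − 1)` on the curve, `j = 1, …, 5`. -/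
def fix : ℕ → List Eis
  | 1 => [zero]
  | 2 => [zero, one, ⟨-1, 0⟩]
  | 3 => [zero, one, om, zeta]
  | 4 => [zero, one, ⟨-1, 0⟩]
  | 5 => [zero]
  | _ => []

/-- all ordered pairs of distinct positions in a list are incongruent mod `u^j − 1` -/
def incongruent (j : ℕ) (l : List Eis) : Bool :=
  (List.range l.length).all fun i => (List.range l.length).all fun k =>
    (i == k) || !(cong j (l.getD i zero) (l.getD k zero))

/-- The five lists are complete residue systems: size `N(u^j − 1) ∈ {1, 3, 4, 3, 1}` and pairwise
incongruent. -/
theorem fix_complete :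
    ((List.range 5).map fun j' =>
      decide ((fix (j' + 1)).length = Int.toNat (norm (sub (upow (j' + 1)) one))) &&
        incongruent (j' + 1) (fix (j' + 1))) =
      [true, true, true, true, true] := by decide

/-- `u = ζ₆^5` and `u · ζ₆ = 1` (the convention `ζ₆ = u⁻¹`). -/
theorem u_convention : upow 1 = u ∧ mul u zeta = one := by decide

/-- a divisor class `a p + b q + n₀ c₀ + n₁ c₁ + n₂ c₂` on `S`. -/
structure Dv where
  /-- coefficient of `p` -/
  a : ℤ
  /-- coefficient of `q` -/
  b : ℤ
  /-- coefficient of `c₀` -/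
  n0 : ℤ
  /-- coefficient of `c₁` -/
  n1 : ℤ
  /-- coefficient of `c₂` -/
  n2 : ℤ
deriving DecidableEq, Repr

/-- indicator of a Boolean as an integer -/
def indic (t : Bool) : ℤ := if t then 1 else 0

/-- `ω^z = ζ₆^{2z}` -/
def wpow (z : ℕ) : Eis := zpow (2 * z % 6)

/-- the multiplicity `m_D(Q)` of `D` at the fixed point `Q = (P₁, P₂)` of `ζ^j`:
`a [P₁ ≡ o] + b [P₂ ≡ o] + Σ_z n_z [P₂ ≡ ω^z P₁]` (congruences mod `u^j − 1`). -/
def mult (D : Dv) (j : ℕ) (P1 P2 : Eis) : ℤ :=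
  D.a * indic (cong j P1 zero) + D.b * indic (cong j P2 zero) +
    D.n0 * indic (cong j P2 (mul (wpow 0) P1)) + D.n1 * indic (cong j P2 (mul (wpow 1) P1)) +
    D.n2 * indic (cong j P2 (mul (wpow 2) P1))

/-- sum of a list in `ℤ[ω]` -/
def esum (l : List Eis) : Eis := l.foldl add zero

/-- the fixed-point side `Σ_{Q ∈ Fix(ζ^j)²} ζ₆^{j m_D(Q)}` (without the denominator). -/
def lefSum (D : Dv) (j : ℕ) : Eis :=
  esum ((fix j).flatMap fun P1 => (fix j).map fun P2 => zpowInt (j * mult D j P1 P2))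

/-- the cohomology side for CLAIMED character data `[(degree, characters)]`:
`Σ_i (−1)^i Σ_{k ∈ chars_i} ζ₆^{jk}`. -/
def virt (chars : List (ℕ × List ℤ)) (j : ℕ) : Eis :=
  esum (chars.map fun ic =>
    let s := esum (ic.2.map fun k => zpowInt (j * k))
    if ic.1 % 2 == 0 then s else neg s)

/-- `(1 − u^j)` -/
def oneMinusU (j : ℕ) : Eis := sub one (upow j)

/-- the Atiyah–Bott identity, denominators cleared, at `j = 1, …, 5`. -/
def abCheck (D : Dv) (chars : List (ℕ × List ℤ)) : Bool :=
  (List.range 5).all fun j' =>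
    decide (mul (mul (oneMinusU (j' + 1)) (oneMinusU (j' + 1))) (virt chars (j' + 1)) =
      lefSum D (j' + 1))

/-- the Hermitian (Néron–Severi) form of `D` in `SlotFrameHexagon`'s dictionary. -/
def hermOf (D : Dv) : Herm :=
  add (add (smul D.a P) (smul D.b Q))
    (add (smul D.n0 (c 0)) (add (smul D.n1 (c 1)) (smul D.n2 (c 2))))

/-- Euler characteristic check: `Σ_i (−1)^i (number of claimed characters in degree i) = det M_D`. -/
def chiCheck (D : Dv) (chars : List (ℕ × List ℤ)) : Bool :=
  (chars.foldl (fun acc ic =>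
      if ic.1 % 2 == 0 then acc + (ic.2.length : ℤ) else acc - (ic.2.length : ℤ)) (0 : ℤ))
    == det (hermOf D)

/-- The character TABLE: divisor ↦ claimed characters by degree (charges.py convention). Rows:
`𝒪`; `c₁`; `−c₁`; `−c₂`; `2H − c₁`; `c₁ − 2H`; `𝒫₁ = c₁ − H`; `−𝒫₁`; `𝒫₂`; `−𝒫₂`; `−2H`;
`c₀ − c₁`; `H`; `2H`; `−H`; `q − c₁`; `c₁ − q`; `−c₁ − H`; `c₁ − 3H`; `2p + q`; `c₁ − c₂`. -/
def table : List (Dv × List (ℕ × List ℤ)) :=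
  [ (⟨0, 0, 0, 0, 0⟩, [(0, [0]), (1, [1, 1]), (2, [2])]),
    (⟨0, 0, 0, 1, 0⟩, [(0, [0]), (1, [1])]),
    (⟨0, 0, 0, -1, 0⟩, [(1, [1]), (2, [2])]),
    (⟨0, 0, 0, 0, -1⟩, [(1, [1]), (2, [2])]),
    (⟨2, 2, 0, -1, 0⟩, [(0, [2]), (1, [3])]),
    (⟨-2, -2, 0, 1, 0⟩, [(1, [5]), (2, [0])]),
    (⟨-1, -1, 0, 1, 0⟩, [(1, [0])]),
    (⟨1, 1, 0, -1, 0⟩, [(1, [2])]),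
    (⟨-1, -1, 0, 0, 1⟩, [(1, [0])]),
    (⟨1, 1, 0, 0, -1⟩, [(1, [2])]),
    (⟨-2, -2, 0, 0, 0⟩, [(2, [0, 0, 2, 4])]),
    (⟨0, 0, 1, -1, 0⟩, [(1, [1, 1, 4])]),
    (⟨1, 1, 0, 0, 0⟩, [(0, [0])]),
    (⟨2, 2, 0, 0, 0⟩, [(0, [0, 2, 2, 4])]),
    (⟨-1, -1, 0, 0, 0⟩, [(2, [2])]),
    (⟨0, 1, 0, -1, 0⟩, [(1, [1])]),
    (⟨0, -1, 0, 1, 0⟩, [(1, [1])]),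
    (⟨-1, -1, 0, -1, 0⟩, [(2, [1, 2, 5])]),
    (⟨-3, -3, 0, 1, 0⟩, [(2, [0, 3, 5])]),
    (⟨2, 1, 0, 0, 0⟩, [(0, [0, 2])]),
    (⟨0, 0, 0, 1, -1⟩, [(1, [1, 1, 4])]) ]

/-- Every row of the table satisfies the Atiyah–Bott identity at `j = 1, …, 5` AND the Euler
characteristic check against `det M_D`. -/
theorem table_checks :
    table.map (fun row => abCheck row.1 row.2 && chiCheck row.1 row.2) = List.replicate 21 true := by
  decide

/-- The sanity row behind the convention: for `𝒪_S` the fixed-point side is `Σ_Q 1 = N(u^j − 1)²`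
for every `j` (so that, with `H⁰ ↔ [0]` and `H² ↔ [2]`, the identity forces `H¹(𝒪) ↔ [1, 1]`:
the class `x²/(2y)`, resp. `dz̄`, has character `1` on each factor — row 1 of `table_checks`). -/
theorem structure_sheaf_row :
    ((List.range 5).map fun j' =>
      decide (lefSum ⟨0, 0, 0, 0, 0⟩ (j' + 1) =
        ⟨norm (sub (upow (j' + 1)) one) * norm (sub (upow (j' + 1)) one), 0⟩)) =
      [true, true, true, true, true] := by decide

end LefschetzCharacterIndex

end Summit.Ventures.HSemireg
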